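import Summits.CriticalPhenomena.PercolationContinuityZ3.Theorems.PercNearOneGluingNoHeavyQuantFarBundlePocket
import HarnessLib

/-!
# QUANT lane R8, front "FAR beyond trees", layer one — A TWO-RELAY EAR AT THE OBSERVER, I: reachability and the relay count

builds on p205010 (kernel theorem, internal audit signed; external expert review pending)

Support file (`--supports stmt-CriticalPhenomena-4575`), seat `prim-quant-p1` (gen 26); memo
`run/shared/lean/prim/quant/prim-quant-p1-g26/FOR-LEAD-EAR-AT-OBSERVER.md` §1–§2.  Pure combinatorics of open paths (no measure);
standard axioms; no sorries; no definitions.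

**Setting.**  Vertices `Fin n`; the observer `o`; a relay `v` whose only positive pairs are `s(o, v)` (to the observer) and `s(v, u)` (to a
second relay `u`, which may have arbitrary further pairs).  A configuration `ω` is GOOD when every open pair at `v` other than these two is
absent (`s(v, z) ∉ ω` for `z ∉ {o, u, v}`) — almost surely so (file II).  Write `x ~ y off v` for reachability through the open pairs
AVOIDING `v` (`Bundle.offZ {v}`).

* `EarAtObserver.inv_of_walk` — the walk invariant: on a good configuration an open walk to a target `x ≠ v` either avoids `v`
  (then its start is joined to `x` off `v`) or crosses `v` through BOTH pairs `s(o,v)`, `s(v,u)`;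
* **`EarAtObserver.reach_iff_of_ne`**: for `x ≠ v`, `o ↔ x ⟺ o ~ x off v ∨ (s(o,v), s(v,u) open ∧ u ~ x off v)`;
  **`EarAtObserver.reach_v_iff`**: `o ↔ v ⟺ s(o,v) open ∨ (s(v,u) open ∧ o ~ u off v)`; `reach_u_iff`;
* **`EarAtObserver.card_le_one_iff`** — with `K₁ = #{a ∈ A ∖ v : o ~ a off v}` (relays `u, v ∈ A`, `o ∉ A`):
  `#{a ∈ A : o ↔ a} ≤ 1 ⟺ (s(o,v) ∈ ω ∧ s(v,u) ∉ ω ∧ K₁ = 0) ∨ (s(o,v) ∉ ω ∧ s(v,u) ∈ ω ∧ ¬ o ~ u off v ∧ K₁ ≤ 1) ∨ (both absent ∧ K₁ ≤ 1)`;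
* the pointwise first-moment bounds `EarAtObserver.sum_reach_le` (`Σ_{b ∈ A'} [o ~ b off v] ≤ [¬G ∧ K₁ = 1] + |A'|·[K₁ ≥ 2]`) and
  `EarAtObserver.sum_feed_le` (`Σ_{b ∈ A'} [o ≁ b, u ~ b off v] ≤ |A'|·[K₁ = 0] + (|A'| − 1)·[¬G ∧ K₁ ≥ 1]`), `A' = A ∖ {u, v}`, `G = [o ~ u off v]`.
So the observer's relay count is an explicit function of the two independent pairs at `v` and of the off-`v` configuration — the bilinear
structure used in file II.  [cite: Grimmett1999, §1.3 p. 10] (open paths / clusters); the bookkeeping is [this work].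
-/

namespace Summit.CriticalPhenomena.PercolationContinuityZ3.Theorems

namespace Quant

namespace EarAtObserver

open Finset
open Literature.Probability.Percolation
open Bundle (offZ offZ_subset reachable_of_offZ)
open scoped Classical

variable {n : ℕ} {o v u : Fin n}

/-- An open pair avoiding `v` is an edge of the off-`v` open graph. [this work] -/
theorem adj_off {ω : BondConfig (Fin n)} {x y : Fin n} (hxy : x ≠ y) (he : s(x, y) ∈ ω) (hx : x ≠ v) (hy : y ≠ v) :
    (openGraph (offZ {v} ω)).Adj x y := by
  rw [openGraph_adj]
  refine ⟨⟨he, fun z hz => ?_⟩, hxy⟩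
  rw [Finset.mem_singleton] at hz
  subst hz
  rw [Sym2.mem_iff, not_or]
  exact ⟨fun h => hx h.symm, fun h => hy h.symm⟩

/-- On a good configuration an open pair at `v` goes to `o` or to `u`. [this work] -/
theorem eq_or_eq_of_mem {ω : BondConfig (Fin n)} (hω : ∀ z : Fin n, z ≠ o → z ≠ u → z ≠ v → s(v, z) ∉ ω) {z : Fin n}
    (hzv : z ≠ v) (hz : s(v, z) ∈ ω) : z = o ∨ z = u := by
  by_contra h
  rw [not_or] at h
  exact hω z h.1 h.2 hzv hz

/-- **The walk invariant.**  Good configuration, target `x ≠ v`: along an open walk from `y` to `x`, if `y ≠ v` then `y ~ x off v`, or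
`y ~ o off v` and the walk may be rerouted `o – v – u ~ x` (both pairs at `v` open, `u ~ x off v`), or symmetrically `y ~ u off v`, both
pairs open and `o ~ x off v`; if `y = v` then `s(o,v)` is open and `o ~ x off v`, or `s(v,u)` is open and `u ~ x off v`. [this work] -/
theorem inv_of_walk {ω : BondConfig (Fin n)} (hω : ∀ z : Fin n, z ≠ o → z ≠ u → z ≠ v → s(v, z) ∉ ω) :
    ∀ (y x : Fin n) (_ : (openGraph ω).Walk y x), x ≠ v →
      (y ≠ v → ((openGraph (offZ {v} ω)).Reachable y x ∨
        ((openGraph (offZ {v} ω)).Reachable y o ∧ s(o, v) ∈ ω ∧ s(v, u) ∈ ω ∧ (openGraph (offZ {v} ω)).Reachable u x) ∨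
        ((openGraph (offZ {v} ω)).Reachable y u ∧ s(o, v) ∈ ω ∧ s(v, u) ∈ ω ∧ (openGraph (offZ {v} ω)).Reachable o x))) ∧
      (y = v → ((s(o, v) ∈ ω ∧ (openGraph (offZ {v} ω)).Reachable o x) ∨
        (s(v, u) ∈ ω ∧ (openGraph (offZ {v} ω)).Reachable u x))) := by
  intro y x W
  induction W with
  | nil => exact fun hx => ⟨fun _ => Or.inl (SimpleGraph.Reachable.refl _), fun h => absurd h hx⟩
  | @cons a b c hadj W' ih =>
    intro hx
    have ih' := ih hx
    rw [openGraph_adj] at hadj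
    obtain ⟨hab, hne⟩ := hadj
    by_cases hav : a = v
    · -- the walk starts at `v`: the first step goes to `o` or `u`
      subst hav
      have hbv : b ≠ a := fun h => hne h.symm
      refine ⟨fun h => absurd rfl h, fun _ => ?_⟩
      rcases eq_or_eq_of_mem hω hbv hab with hbo | hbu
      · subst hbo
        have hp : s(b, a) ∈ ω := by rw [Sym2.eq_swap]; exact hab
        rcases ih'.1 hbv with h | ⟨-, -, hr, h⟩ | ⟨-, -, -, h⟩
        · exact Or.inl ⟨hp, h⟩
        · exact Or.inr ⟨hr, h⟩
        · exact Or.inl ⟨hp, h⟩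
      · subst hbu
        rcases ih'.1 hbv with h | ⟨-, -, -, h⟩ | ⟨-, hp, -, h⟩
        · exact Or.inr ⟨hab, h⟩
        · exact Or.inr ⟨hab, h⟩
        · exact Or.inl ⟨hp, h⟩
    · refine ⟨fun _ => ?_, fun h => absurd h hav⟩
      by_cases hbv : b = v
      · -- the step enters `v`, so `a ∈ {o, u}`
        subst hbv
        have hba : s(b, a) ∈ ω := by rw [Sym2.eq_swap]; exact hab
        rcases eq_or_eq_of_mem hω hav hba with hao | hau
        · subst hao
          rcases ih'.2 rfl with ⟨-, h⟩ | ⟨hr, h⟩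
          · exact Or.inl h
          · exact Or.inr (Or.inl ⟨SimpleGraph.Reachable.refl _, hab, hr, h⟩)
        · subst hau
          rcases ih'.2 rfl with ⟨hp, h⟩ | ⟨-, h⟩
          · exact Or.inr (Or.inr ⟨SimpleGraph.Reachable.refl _, hp, hba, h⟩)
          · exact Or.inl h
      · -- an off-`v` step
        have hadj' : (openGraph (offZ {v} ω)).Adj a b := adj_off hne hab hav hbv
        rcases ih'.1 hbv with h | ⟨h1, hp, hr, h⟩ | ⟨h1, hp, hr, h⟩
        · exact Or.inl (hadj'.reachable.trans h)
        · exact Or.inr (Or.inl ⟨hadj'.reachable.trans h1, hp, hr, h⟩)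
        · exact Or.inr (Or.inr ⟨hadj'.reachable.trans h1, hp, hr, h⟩)

/-- **Vertices other than `v`.**  On a good configuration, for `x ≠ v`: `o ↔ x ⟺ o ~ x off v ∨ (s(o,v) ∈ ω ∧ s(v,u) ∈ ω ∧ u ~ x off v)`.
[this work] -/
theorem reach_iff_of_ne {ω : BondConfig (Fin n)} (hω : ∀ z : Fin n, z ≠ o → z ≠ u → z ≠ v → s(v, z) ∉ ω)
    (hov : o ≠ v) (huv : u ≠ v) {x : Fin n} (hx : x ≠ v) :
    (openGraph ω).Reachable o x ↔ (openGraph (offZ {v} ω)).Reachable o x ∨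
      (s(o, v) ∈ ω ∧ s(v, u) ∈ ω ∧ (openGraph (offZ {v} ω)).Reachable u x) := by
  constructor
  · rintro ⟨W⟩
    rcases (inv_of_walk hω o x W hx).1 hov with h | ⟨-, hp, hr, h⟩ | ⟨-, -, -, h⟩
    · exact Or.inl h
    · exact Or.inr ⟨hp, hr, h⟩
    · exact Or.inl h
  · rintro (h | ⟨hp, hr, h⟩)
    · exact reachable_of_offZ h
    · have h1 : (openGraph ω).Adj o v := by rw [openGraph_adj]; exact ⟨hp, hov⟩
      have h2 : (openGraph ω).Adj v u := by rw [openGraph_adj]; exact ⟨hr, huv.symm⟩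
      exact h1.reachable.trans (h2.reachable.trans (reachable_of_offZ h))

/-- **The relay `u`.**  On a good configuration: `o ↔ u ⟺ (s(o,v) ∈ ω ∧ s(v,u) ∈ ω) ∨ o ~ u off v`. [this work] -/
theorem reach_u_iff {ω : BondConfig (Fin n)} (hω : ∀ z : Fin n, z ≠ o → z ≠ u → z ≠ v → s(v, z) ∉ ω)
    (hov : o ≠ v) (huv : u ≠ v) :
    (openGraph ω).Reachable o u ↔ (s(o, v) ∈ ω ∧ s(v, u) ∈ ω) ∨ (openGraph (offZ {v} ω)).Reachable o u := by
  rw [reach_iff_of_ne hω hov huv huv]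
  constructor
  · rintro (h | ⟨hp, hr, -⟩)
    · exact Or.inr h
    · exact Or.inl ⟨hp, hr⟩
  · rintro (⟨hp, hr⟩ | h)
    · exact Or.inr ⟨hp, hr, SimpleGraph.Reachable.refl _⟩
    · exact Or.inl h

/-- **The relay `v`.**  On a good configuration: `o ↔ v ⟺ s(o,v) ∈ ω ∨ (s(v,u) ∈ ω ∧ o ~ u off v)`. [this work] -/
theorem reach_v_iff {ω : BondConfig (Fin n)} (hω : ∀ z : Fin n, z ≠ o → z ≠ u → z ≠ v → s(v, z) ∉ ω)
    (hov : o ≠ v) (huv : u ≠ v) :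
    (openGraph ω).Reachable o v ↔ s(o, v) ∈ ω ∨ (s(v, u) ∈ ω ∧ (openGraph (offZ {v} ω)).Reachable o u) := by
  constructor
  · intro h
    obtain ⟨W⟩ := h.symm
    cases W with
    | nil => exact absurd rfl hov
    | cons hadj W' =>
      rename_i b
      rw [openGraph_adj] at hadj
      obtain ⟨hvb, hne⟩ := hadj
      rcases eq_or_eq_of_mem hω (fun h' => hne h'.symm) hvb with hbo | hbu
      · subst hbo
        left; rw [Sym2.eq_swap]; exact hvb
      · subst hbu
        have hou : (openGraph ω).Reachable o b := ⟨W'.reverse⟩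
        rcases (reach_iff_of_ne hω hov huv huv).1 hou with h' | ⟨hp, -, -⟩
        · exact Or.inr ⟨hvb, h'⟩
        · exact Or.inl hp
  · rintro (hp | ⟨hr, h⟩)
    · have h1 : (openGraph ω).Adj o v := by rw [openGraph_adj]; exact ⟨hp, hov⟩
      exact h1.reachable
    · have h2 : (openGraph ω).Adj u v := by rw [openGraph_adj, Sym2.eq_swap]; exact ⟨hr, huv⟩
      exact (reachable_of_offZ h).trans h2.reachable

/-! ## The relay count -/

/-- Splitting the relay count at `v`: `#{a ∈ A : o ↔ a} = [o ↔ v] + #{a ∈ A ∖ v : o ↔ a}` (`v ∈ A`). [this work] -/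
theorem card_filter_eq_ite_add {ω : BondConfig (Fin n)} {A : Finset (Fin n)} (hvA : v ∈ A) :
    (A.filter fun a => ω ∈ openConn o a).card =
      (if ω ∈ openConn o v then 1 else 0) + ((A.erase v).filter fun a => ω ∈ openConn o a).card := by
  conv_lhs => rw [← insert_erase hvA]
  rw [filter_insert]
  by_cases h : ω ∈ openConn o v
  · rw [if_pos h, if_pos h, card_insert_of_notMem (fun h' => notMem_erase v A (mem_filter.1 h').1), add_comm]
  · rw [if_neg h, if_neg h, zero_add]

/-- On a good configuration without the crossing (`¬(s(o,v) ∈ ω ∧ s(v,u) ∈ ω)`), the relays other than `v` reached by `o` are exactly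
those reached off `v`. [this work] -/
theorem filter_erase_eq_of_not_cross {ω : BondConfig (Fin n)} (hω : ∀ z : Fin n, z ≠ o → z ≠ u → z ≠ v → s(v, z) ∉ ω)
    (hov : o ≠ v) (huv : u ≠ v) (hT : ¬ (s(o, v) ∈ ω ∧ s(v, u) ∈ ω)) (A : Finset (Fin n)) :
    ((A.erase v).filter fun a => ω ∈ openConn o a) = ((A.erase v).filter fun a => offZ {v} ω ∈ openConn o a) := by
  refine filter_congr fun a ha => ?_
  have hav : a ≠ v := (mem_erase.1 ha).1
  show (openGraph ω).Reachable o a ↔ (openGraph (offZ {v} ω)).Reachable o a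
  rw [reach_iff_of_ne hω hov huv hav]
  constructor
  · rintro (h | ⟨hp, hr, -⟩)
    · exact h
    · exact absurd ⟨hp, hr⟩ hT
  · exact fun h => Or.inl h

/-- **The event `N ≤ 1` on a good configuration** (`u, v ∈ A`, `o ∉ A`), in terms of the two pairs at `v` and of
`K₁ = #{a ∈ A ∖ v : o ~ a off v}`. [this work] -/
theorem card_le_one_iff {ω : BondConfig (Fin n)} (hω : ∀ z : Fin n, z ≠ o → z ≠ u → z ≠ v → s(v, z) ∉ ω)
    (hov : o ≠ v) (huv : u ≠ v) {A : Finset (Fin n)} (hvA : v ∈ A) (huA : u ∈ A) :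
    (A.filter fun a => ω ∈ openConn o a).card ≤ 1 ↔
      (s(o, v) ∈ ω ∧ s(v, u) ∉ ω ∧ ((A.erase v).filter fun a => offZ {v} ω ∈ openConn o a).card = 0) ∨
      (s(o, v) ∉ ω ∧ s(v, u) ∈ ω ∧ ¬ (openGraph (offZ {v} ω)).Reachable o u ∧
        ((A.erase v).filter fun a => offZ {v} ω ∈ openConn o a).card ≤ 1) ∨
      (s(o, v) ∉ ω ∧ s(v, u) ∉ ω ∧ ((A.erase v).filter fun a => offZ {v} ω ∈ openConn o a).card ≤ 1) := by
  have huA' : u ∈ A.erase v := mem_erase.2 ⟨huv, huA⟩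
  rw [card_filter_eq_ite_add hvA]
  by_cases hp : s(o, v) ∈ ω <;> by_cases hr : s(v, u) ∈ ω
  · -- crossing: `u` and `v` are both reached
    have hv : ω ∈ openConn o v := (reach_v_iff hω hov huv).2 (Or.inl hp)
    have hu : ω ∈ openConn o u := (reach_u_iff hω hov huv).2 (Or.inl ⟨hp, hr⟩)
    have h1 : 1 ≤ ((A.erase v).filter fun a => ω ∈ openConn o a).card :=
      card_pos.2 ⟨u, mem_filter.2 ⟨huA', hu⟩⟩
    rw [if_pos hv]
    constructor
    · intro h; omega
    · rintro (⟨-, h, -⟩ | ⟨h, -⟩ | ⟨h, -⟩)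
      · exact absurd hr h
      · exact absurd hp h
      · exact absurd hp h
  · have hv : ω ∈ openConn o v := (reach_v_iff hω hov huv).2 (Or.inl hp)
    rw [if_pos hv, filter_erase_eq_of_not_cross hω hov huv (fun h => hr h.2) A]
    constructor
    · intro h; exact Or.inl ⟨hp, hr, by omega⟩
    · rintro (⟨-, -, h⟩ | ⟨h, -⟩ | ⟨h, -⟩)
      · omega
      · exact absurd hp h
      · exact absurd hp h
  · rw [filter_erase_eq_of_not_cross hω hov huv (fun h => hp h.1) A]
    by_cases hG : (openGraph (offZ {v} ω)).Reachable o u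
    · have hv : ω ∈ openConn o v := (reach_v_iff hω hov huv).2 (Or.inr ⟨hr, hG⟩)
      have h1 : 1 ≤ ((A.erase v).filter fun a => offZ {v} ω ∈ openConn o a).card :=
        card_pos.2 ⟨u, mem_filter.2 ⟨huA', hG⟩⟩
      rw [if_pos hv]
      constructor
      · intro h; omega
      · rintro (⟨h, -⟩ | ⟨-, -, h, -⟩ | ⟨-, h, -⟩)
        · exact absurd h hp
        · exact absurd hG h
        · exact absurd hr h
    · have hv : ω ∉ openConn o v := by
        intro h
        rcases (reach_v_iff hω hov huv).1 h with h' | ⟨-, h'⟩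
        · exact hp h'
        · exact hG h'
      rw [if_neg hv, zero_add]
      constructor
      · intro h; exact Or.inr (Or.inl ⟨hp, hr, hG, h⟩)
      · rintro (⟨h, -⟩ | ⟨-, -, -, h⟩ | ⟨-, h, -⟩)
        · exact absurd h hp
        · exact h
        · exact absurd hr h
  · rw [filter_erase_eq_of_not_cross hω hov huv (fun h => hp h.1) A]
    have hv : ω ∉ openConn o v := by
      intro h
      rcases (reach_v_iff hω hov huv).1 h with h' | ⟨h', -⟩
      · exact hp h'
      · exact hr h'
    rw [if_neg hv, zero_add]
    constructor
    · intro h; exact Or.inr (Or.inr ⟨hp, hr, h⟩)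
    · rintro (⟨h, -⟩ | ⟨-, h, -⟩ | ⟨-, -, h⟩)
      · exact absurd h hp
      · exact absurd h hr
      · exact h

/-! ## Pointwise first-moment bounds (off `v`, no goodness needed) -/

/-- `K₁` splits off `u`: `#{a ∈ A ∖ v : o ~ a off v} = [o ~ u off v] + #{b ∈ A ∖ {u,v} : o ~ b off v}`. [this work] -/
theorem card_filter_erase_eq {ω : BondConfig (Fin n)} (huv : u ≠ v) {A : Finset (Fin n)} (huA : u ∈ A) :
    ((A.erase v).filter fun a => offZ {v} ω ∈ openConn o a).card =
      (if (openGraph (offZ {v} ω)).Reachable o u then 1 else 0) +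
        (((A.erase v).erase u).filter fun a => offZ {v} ω ∈ openConn o a).card := by
  have huA' : u ∈ A.erase v := mem_erase.2 ⟨huv, huA⟩
  conv_lhs => rw [← insert_erase huA']
  rw [filter_insert]
  by_cases h : (openGraph (offZ {v} ω)).Reachable o u
  · have h' : offZ {v} ω ∈ openConn o u := h
    rw [if_pos h', if_pos h, card_insert_of_notMem (fun h'' => notMem_erase u _ (mem_filter.1 h'').1), add_comm]
  · have h' : offZ {v} ω ∉ openConn o u := h
    rw [if_neg h', if_neg h, zero_add]

/-- **First-moment bound for the outside relays joined to `o` off `v`:**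
`Σ_{b ∈ A'} [o ~ b off v] ≤ [¬ o ~ u off v ∧ K₁ = 1] + |A'|·[2 ≤ K₁]`, `A' = A ∖ {u, v}`. [this work] -/
theorem sum_reach_le {ω : BondConfig (Fin n)} (huv : u ≠ v) {A : Finset (Fin n)} (huA : u ∈ A) :
    (∑ b ∈ (A.erase v).erase u, (if offZ {v} ω ∈ openConn o b then (1 : ℝ) else 0)) ≤
      (if (¬ (openGraph (offZ {v} ω)).Reachable o u ∧ ((A.erase v).filter fun a => offZ {v} ω ∈ openConn o a).card = 1)
          then (1 : ℝ) else 0) +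
        ((A.erase v).erase u).card *
          (if 2 ≤ ((A.erase v).filter fun a => offZ {v} ω ∈ openConn o a).card then (1 : ℝ) else 0) := by
  have hsplit := card_filter_erase_eq (o := o) (ω := ω) huv huA
  set A' := (A.erase v).erase u with hA'
  set K := (A'.filter fun a => offZ {v} ω ∈ openConn o a).card with hK
  have hsum : (∑ b ∈ A', (if offZ {v} ω ∈ openConn o b then (1 : ℝ) else 0)) = K := by
    rw [hK, natCast_card_filter]
  have hKle : K ≤ A'.card := card_filter_le _ _
  rw [hsum]
  by_cases h2 : 2 ≤ ((A.erase v).filter fun a => offZ {v} ω ∈ openConn o a).card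
  · rw [if_pos h2]
    have hK' : (K : ℝ) ≤ A'.card := by exact_mod_cast hKle
    have h0 : (0 : ℝ) ≤ (if (¬ (openGraph (offZ {v} ω)).Reachable o u ∧
        ((A.erase v).filter fun a => offZ {v} ω ∈ openConn o a).card = 1) then (1 : ℝ) else 0) := by positivity
    linarith
  · rw [if_neg h2, mul_zero, add_zero]
    by_cases hG : (openGraph (offZ {v} ω)).Reachable o u
    · rw [if_pos hG] at hsplit
      have : K = 0 := by omega
      rw [this]; push_cast; positivity
    · rw [if_neg hG, zero_add] at hsplit
      by_cases h1 : ((A.erase v).filter fun a => offZ {v} ω ∈ openConn o a).card = 1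
      · rw [if_pos ⟨hG, h1⟩]
        have : K = 1 := by omega
        rw [this]; push_cast; exact le_refl _
      · rw [if_neg (fun h => h1 h.2)]
        have : K = 0 := by omega
        rw [this]; push_cast; exact le_refl _

/-- **First-moment bound for the feedback relays** (joined to `u` but not to `o` off `v`):
`Σ_{b ∈ A'} [o ≁ b ∧ u ~ b off v] ≤ |A'|·[K₁ = 0] + (|A'| − 1)·[¬ o ~ u off v ∧ 1 ≤ K₁]`. [this work] -/
theorem sum_feed_le {ω : BondConfig (Fin n)} (huv : u ≠ v) {A : Finset (Fin n)} (huA : u ∈ A) :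
    (∑ b ∈ (A.erase v).erase u,
        (if ¬ (openGraph (offZ {v} ω)).Reachable o b ∧ (openGraph (offZ {v} ω)).Reachable u b then (1 : ℝ) else 0)) ≤
      ((A.erase v).erase u).card * (if ((A.erase v).filter fun a => offZ {v} ω ∈ openConn o a).card = 0 then (1 : ℝ) else 0) +
        (((A.erase v).erase u).card - 1) *
          (if (¬ (openGraph (offZ {v} ω)).Reachable o u ∧ 1 ≤ ((A.erase v).filter fun a => offZ {v} ω ∈ openConn o a).card)
            then (1 : ℝ) else 0) := by
  have hsplit := card_filter_erase_eq (o := o) (ω := ω) huv huA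
  set A' := (A.erase v).erase u with hA'
  set Gr := openGraph (offZ {v} ω) with hGr
  set K := (A'.filter fun a => offZ {v} ω ∈ openConn o a).card with hK
  set F := (A'.filter fun b => ¬ Gr.Reachable o b ∧ Gr.Reachable u b).card with hF
  have hsum : (∑ b ∈ A', (if ¬ Gr.Reachable o b ∧ Gr.Reachable u b then (1 : ℝ) else 0)) = F := by
    rw [hF, natCast_card_filter]
  -- the two filters are disjoint subsets of `A'`
  have hFK : F + K ≤ A'.card := by
    rw [hF, hK, ← card_union_of_disjoint]
    · exact card_le_card (union_subset (filter_subset _ _) (filter_subset _ _))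
    · rw [disjoint_filter]
      intro b _ h h'
      exact h.1 h'
  rw [hsum]
  by_cases hG : Gr.Reachable o u
  · -- then every vertex joined to `u` is joined to `o`: `F = 0`
    have hF0 : F = 0 := by
      rw [hF, card_eq_zero, filter_eq_empty_iff]
      rintro b - ⟨h, h'⟩
      exact h (hG.trans h')
    have hneg : ¬ (¬ Gr.Reachable o u ∧ 1 ≤ ((A.erase v).filter fun a => offZ {v} ω ∈ openConn o a).card) :=
      fun h => h.1 hG
    rw [hF0, if_neg hneg, mul_zero, add_zero]
    have h0 : (0 : ℝ) ≤ (if ((A.erase v).filter fun a => offZ {v} ω ∈ openConn o a).card = 0 then (1 : ℝ) else 0) := by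
      split <;> norm_num
    push_cast
    exact mul_nonneg (Nat.cast_nonneg _) h0
  · rw [if_neg hG, zero_add] at hsplit
    by_cases hK0 : ((A.erase v).filter fun a => offZ {v} ω ∈ openConn o a).card = 0
    · rw [if_pos hK0, if_neg (fun h => by obtain ⟨_, h⟩ := h; omega), mul_one, mul_zero, add_zero]
      have : F ≤ A'.card := by omega
      exact_mod_cast this
    · rw [if_neg hK0, mul_zero, zero_add, if_pos ⟨hG, by omega⟩, mul_one]
      have h1 : 1 ≤ K := by omega
      have : F + 1 ≤ A'.card := by omega
      have : (F : ℝ) + 1 ≤ A'.card := by exact_mod_cast this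
      linarith

end EarAtObserver

end Quant

end Summit.CriticalPhenomena.PercolationContinuityZ3.Theorems
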